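import Summits.PneNP.PneNP.Theorems.ChebyshevTracialDesignProjectionNormalForm
import HarnessLib

/-!
# Cell pnp-psdrank, route `ChebyshevTracialDesign`: the PSD BEST RESPONSE — against fixed matching-side matrices the best
# cut-side contraction is the spectral projector of the response, and the value is the positive-eigenvalue sum

Engine brick (eng g11), the kernel form of the closed-form half-step of the cell's psd see-saws (prover g9 ASK
2026-08-27T08:37Z, (T2): "for fixed `Y'` the optimal `X'_U` is the spectral projector `1_{>0}(Σ_M W̃(U,M) Y'_M)` and the
value is `Σ_U tr⁺(Σ_M W̃(U,M) Y'_M)` — linear algebra, no SDP solver"). For the crux `TracialDecayExp20`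
(stmt-PneNP-19878) the value of a psd rectangle `(X, Y)` of dimension `r` against a weight `W` is
`Σ_{U,M} W(U,M)·tr(X_U Y_M) = Σ_U tr(X_U·G_U)` with the RESPONSE matrices `G_U := Σ_M W(U,M)·Y_M` (§2, `value_eq_sum_response`).

* §1 `trace_mul_le_sum_posPart`: for a real symmetric `Z = O·diag(z)·Oᵀ` (`OᵀO = I`) and ANY contraction `0 ⪯ X ⪯ I`,
  `tr(X Z) ≤ Σ_i max(0, z_i)`; the spectral projector `O·diag(1[z_i > 0])·Oᵀ` is a projection contraction attaining it
  (`posProj_attains`). (Diagonal entries of `OᵀXO` lie in `[0,1]`, `conj_diag_mem_unitInterval`.)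
* §2 `value_le_sum_posPart`: hence for every family of contractions `X_U` (tight or not) and every eigen-decomposition
  `G_U = O_U·diag(z_U)·O_Uᵀ` of the responses, `Σ W tr(X_U Y_M) ≤ Σ_U Σ_i max(0, z_U(i))`, with equality for the
  projector family (`value_posProj_eq`); existence of the eigen-data for symmetric `Y_M` is Mathlib's spectral theorem
  (`exists_eigenbasis_response`).
* §3 `tracialValueLEAt_of_response_bound`: a bound `(Σ_U Σ_i (z_U(i))⁺)/r ≤ γ` valid for the responses of every
  contraction family `Y` gives `TracialValueLEAt W γ r` — the psd analogue of the tree's `r = 1` best-response /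
  rectangle elimination (`…FiniteValued.rectangle_le_bestResponse`, `…DimensionOne.tracialValueLEAt_one_iff`): the
  tightness constraint only lowers the cut side's optimum, so the unconstrained best response is an upper bound for the
  crux functional, and it is the EXACT sup of the tightness-free ("NTF", `…UnconstrainedSquareSlack`) functional over the
  cut side.
[cite: GriblingDelaatLaurent2019, §5] [cite: BrietDadushPokutta2014, Thm. 6 (§3)] [cite: Rothvoss2017, §2 (PDF pp. 6–7)]
Stature: support/instrument (the certificate behind the engine's T2 numerics, MEMO-11). WHAT THIS IS NOT: no bound on any
response spectrum, nothing on psd rank of P_PM, no P-vs-NP content.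
-/

set_option linter.dupNamespace false -- `Summit.PneNP.PneNP.…`: summit = sub-problem (D-0017)

noncomputable section

namespace Summit.PneNP.PneNP.Theorems.ChebyshevTracialDesignPsdBestResponse

open Finset Matrix Literature.Barriers.PneNP Literature.Combinatorics.Optimization
open Summit.PneNP.PneNP.Theorems.ChebyshevTracialDesignCommutative (posSemidef_conj one_sub_conj conj_mul_conj trace_conj)
open Summit.PneNP.PneNP.Theorems.ChebyshevTracialDesignProjectionNormalForm (exists_eigenbasis)

variable {n r : ℕ}

/-! ### §1 One matrix: `tr(X Z) ≤ Σ_i (z_i)⁺` for contractions `X`, attained by the positive spectral projector -/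

/-- In an orthonormal frame (`OᵀO = I`) the diagonal entries of a contraction `0 ⪯ X ⪯ I` lie in `[0, 1]`. -/
theorem conj_diag_mem_unitInterval (O : Matrix (Fin r) (Fin r) ℝ) (hO : Oᵀ * O = 1) {X : Matrix (Fin r) (Fin r) ℝ}
    (h0 : X.PosSemidef) (h1 : (1 - X).PosSemidef) (i : Fin r) :
    0 ≤ (Oᵀ * X * O) i i ∧ (Oᵀ * X * O) i i ≤ 1 := by
  have hpsd : (Oᵀ * X * O).PosSemidef := by
    have h := posSemidef_conj h0 Oᵀ
    rwa [transpose_transpose] at h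
  have hpsd1 : (1 - Oᵀ * X * O).PosSemidef := by
    have h := posSemidef_conj h1 Oᵀ
    have e : Oᵀ * (1 - X) * (Oᵀ)ᵀ = 1 - Oᵀ * X * O := by
      rw [transpose_transpose, Matrix.mul_sub, Matrix.sub_mul, Matrix.mul_one, hO]
    rwa [e] at h
  refine ⟨hpsd.diag_nonneg, ?_⟩
  have h := hpsd1.diag_nonneg (i := i)
  rw [Matrix.sub_apply, Matrix.one_apply_eq] at h
  linarith

/-- For `0 ≤ a ≤ 1`: `a·z ≤ max(0, z)`. -/
theorem mul_le_posPart {a z : ℝ} (ha0 : 0 ≤ a) (ha1 : a ≤ 1) : a * z ≤ max 0 z := by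
  rcases le_or_gt 0 z with hz | hz
  · calc a * z ≤ 1 * z := mul_le_mul_of_nonneg_right ha1 hz
      _ = z := one_mul z
      _ ≤ max 0 z := le_max_right 0 z
  · exact (mul_nonpos_iff.2 (Or.inl ⟨ha0, hz.le⟩)).trans (le_max_left 0 z)

/-- `tr(X·(O diag(z) Oᵀ)) = Σ_i (OᵀXO)_{ii}·z_i`. -/
theorem trace_mul_conj_diagonal (O : Matrix (Fin r) (Fin r) ℝ) (z : Fin r → ℝ) (X : Matrix (Fin r) (Fin r) ℝ) :
    (X * (O * diagonal z * Oᵀ)).trace = ∑ i, (Oᵀ * X * O) i i * z i := by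
  have e : X * (O * diagonal z * Oᵀ) = (X * O * diagonal z) * Oᵀ := by simp only [Matrix.mul_assoc]
  rw [e, Matrix.trace_mul_comm, ← Matrix.mul_assoc, ← Matrix.mul_assoc]
  simp only [Matrix.trace, Matrix.diag_apply, Matrix.mul_diagonal]

/-- **`tr(X Z) ≤ Σ_i max(0, z_i)`** for a real symmetric `Z = O·diag(z)·Oᵀ` (`OᵀO = I`) and every contraction
`0 ⪯ X ⪯ I`: the best response of the cut side is worth the positive-eigenvalue sum. [cite: GriblingDelaatLaurent2019, §5] -/
theorem trace_mul_le_sum_posPart (O : Matrix (Fin r) (Fin r) ℝ) (hO : Oᵀ * O = 1) (z : Fin r → ℝ)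
    {Z X : Matrix (Fin r) (Fin r) ℝ} (hZ : Z = O * diagonal z * Oᵀ) (h0 : X.PosSemidef) (h1 : (1 - X).PosSemidef) :
    (X * Z).trace ≤ ∑ i, max 0 (z i) := by
  rw [hZ, trace_mul_conj_diagonal]
  exact sum_le_sum fun i _ =>
    mul_le_posPart (conj_diag_mem_unitInterval O hO h0 h1 i).1 (conj_diag_mem_unitInterval O hO h0 h1 i).2

/-- The **positive spectral projector** `P = O·diag(1[z_i > 0])·Oᵀ` of `Z = O·diag(z)·Oᵀ` is a projection and a contraction, and
attains `tr(P Z) = Σ_i max(0, z_i)`. -/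
theorem posProj_attains (O : Matrix (Fin r) (Fin r) ℝ) (hO : Oᵀ * O = 1) (z : Fin r → ℝ)
    {Z : Matrix (Fin r) (Fin r) ℝ} (hZ : Z = O * diagonal z * Oᵀ) :
    (O * diagonal (fun i => if 0 < z i then (1 : ℝ) else 0) * Oᵀ).PosSemidef ∧
      (1 - (O * diagonal (fun i => if 0 < z i then (1 : ℝ) else 0) * Oᵀ)).PosSemidef ∧
      (O * diagonal (fun i => if 0 < z i then (1 : ℝ) else 0) * Oᵀ) * (O * diagonal (fun i => if 0 < z i then (1 : ℝ) else 0) * Oᵀ) =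
        (O * diagonal (fun i => if 0 < z i then (1 : ℝ) else 0) * Oᵀ) ∧
      ((O * diagonal (fun i => if 0 < z i then (1 : ℝ) else 0) * Oᵀ) * Z).trace = ∑ i, max 0 (z i) := by
  have hO' : O * Oᵀ = 1 := mul_eq_one_comm.1 hO
  set p : Fin r → ℝ := fun i => if 0 < z i then (1 : ℝ) else 0 with hp
  have hp01 : ∀ i, 0 ≤ p i ∧ p i ≤ 1 := fun i => by
    by_cases h : 0 < z i <;> simp [hp, h]
  refine ⟨?_, ?_, ?_, ?_⟩
  · exact posSemidef_conj (posSemidef_diagonal_iff.2 fun i => (hp01 i).1) O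
  · rw [one_sub_conj _ _ hO', ← diagonal_one, diagonal_sub]
    exact posSemidef_conj (posSemidef_diagonal_iff.2 fun i => sub_nonneg.2 (hp01 i).2) O
  · rw [conj_mul_conj _ _ _ hO, diagonal_mul_diagonal]
    congr 2
    ext i j
    by_cases h : 0 < z i <;> simp [diagonal, hp, h]
  · rw [hZ, conj_mul_conj _ _ _ hO, diagonal_mul_diagonal, trace_conj _ _ hO, trace_diagonal]
    refine sum_congr rfl fun i _ => ?_
    by_cases h : 0 < z i
    · simp [hp, h, max_eq_right h.le]
    · simp [hp, h, max_eq_left (not_lt.1 h)]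

/-! ### §2 The value against fixed `Y`: responses `G_U = Σ_M W(U,M)·Y_M` -/

/-- `Σ_M W(U,M) tr(X_U Y_M) = tr(X_U G_U)`. -/
theorem sum_trace_eq_trace_response (W : OddSet n → PMatch n → ℝ) (X : OddSet n → Matrix (Fin r) (Fin r) ℝ)
    (Y : PMatch n → Matrix (Fin r) (Fin r) ℝ) (U : OddSet n) :
    ∑ M, W U M * (X U * Y M).trace = (X U * (∑ M, W U M • Y M)).trace := by
  simp only [Matrix.mul_sum, Matrix.trace_sum, Matrix.mul_smul, Matrix.trace_smul, smul_eq_mul]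

/-- **Value = Σ_U tr(X_U · response_U)**. -/
theorem value_eq_sum_response (W : OddSet n → PMatch n → ℝ) (X : OddSet n → Matrix (Fin r) (Fin r) ℝ)
    (Y : PMatch n → Matrix (Fin r) (Fin r) ℝ) :
    ∑ U, ∑ M, W U M * (X U * Y M).trace = ∑ U, (X U * (∑ M, W U M • Y M)).trace :=
  sum_congr rfl fun U _ => sum_trace_eq_trace_response W X Y U

/-- The response of a family of symmetric matrices is symmetric. -/
theorem isHermitian_response (W : OddSet n → PMatch n → ℝ) {Y : PMatch n → Matrix (Fin r) (Fin r) ℝ}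
    (hY : ∀ M, (Y M).IsHermitian) (U : OddSet n) : ((∑ M, W U M • Y M)).IsHermitian := by
  induction (Finset.univ : Finset (PMatch n)) using Finset.induction_on with
  | empty => simp [Matrix.IsHermitian]
  | insert M s hM ih =>
    rw [sum_insert hM]
    refine Matrix.IsHermitian.add ?_ ih
    have h := hY M
    unfold Matrix.IsHermitian at h ⊢
    rw [conjTranspose_smul, h, star_trivial]

/-- **Eigen-data of the responses exist** (spectral theorem): for symmetric `Y_M` every response is `O_U·diag(z_U)·O_Uᵀ`
with `O_UᵀO_U = I`. -/
theorem exists_eigenbasis_response (W : OddSet n → PMatch n → ℝ) {Y : PMatch n → Matrix (Fin r) (Fin r) ℝ}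
    (hY : ∀ M, (Y M).IsHermitian) :
    ∃ (O : OddSet n → Matrix (Fin r) (Fin r) ℝ) (z : OddSet n → Fin r → ℝ),
      (∀ U, (O U)ᵀ * O U = 1) ∧ ∀ U, (∑ M, W U M • Y M) = O U * diagonal (z U) * (O U)ᵀ := by
  choose O z hO hG using fun U => exists_eigenbasis (isHermitian_response W hY U)
  exact ⟨O, z, hO, hG⟩

/-- **PSD best-response bound.** For EVERY family of contractions `X_U` (no tightness assumed) and every
eigen-decomposition `G_U = O_U·diag(z_U)·O_Uᵀ` of the responses of `Y`:
`Σ_{U,M} W(U,M) tr(X_U Y_M) ≤ Σ_U Σ_i max(0, z_U(i))`. [cite: GriblingDelaatLaurent2019, §5] -/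
theorem value_le_sum_posPart (W : OddSet n → PMatch n → ℝ) {X : OddSet n → Matrix (Fin r) (Fin r) ℝ}
    (Y : PMatch n → Matrix (Fin r) (Fin r) ℝ) (hX : ∀ U, (X U).PosSemidef ∧ (1 - X U).PosSemidef)
    (O : OddSet n → Matrix (Fin r) (Fin r) ℝ) (z : OddSet n → Fin r → ℝ) (hO : ∀ U, (O U)ᵀ * O U = 1)
    (hG : ∀ U, (∑ M, W U M • Y M) = O U * diagonal (z U) * (O U)ᵀ) :
    ∑ U, ∑ M, W U M * (X U * Y M).trace ≤ ∑ U, ∑ i, max 0 (z U i) := by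
  rw [value_eq_sum_response]
  exact sum_le_sum fun U _ => trace_mul_le_sum_posPart (O U) (hO U) (z U) (hG U) (hX U).1 (hX U).2

/-- **The bound is attained** by the family of positive spectral projectors of the responses (a projection-valued
contraction family; it need NOT be tight — this is the unconstrained, i.e. tightness-free, optimum of the cut side). -/
theorem value_posProj_eq (W : OddSet n → PMatch n → ℝ) (Y : PMatch n → Matrix (Fin r) (Fin r) ℝ)
    (O : OddSet n → Matrix (Fin r) (Fin r) ℝ) (z : OddSet n → Fin r → ℝ) (hO : ∀ U, (O U)ᵀ * O U = 1)
    (hG : ∀ U, (∑ M, W U M • Y M) = O U * diagonal (z U) * (O U)ᵀ) :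
    (∀ U, ((O U * diagonal (fun i => if 0 < z U i then (1 : ℝ) else 0) * (O U)ᵀ)).PosSemidef ∧ (1 - (O U * diagonal (fun i => if 0 < z U i then (1 : ℝ) else 0) * (O U)ᵀ)).PosSemidef ∧
        (O U * diagonal (fun i => if 0 < z U i then (1 : ℝ) else 0) * (O U)ᵀ) * (O U * diagonal (fun i => if 0 < z U i then (1 : ℝ) else 0) * (O U)ᵀ) = (O U * diagonal (fun i => if 0 < z U i then (1 : ℝ) else 0) * (O U)ᵀ)) ∧
      ∑ U, ∑ M, W U M * ((O U * diagonal (fun i => if 0 < z U i then (1 : ℝ) else 0) * (O U)ᵀ) * Y M).trace = ∑ U, ∑ i, max 0 (z U i) := by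
  refine ⟨fun U => ⟨(posProj_attains (O U) (hO U) (z U) (hG U)).1, (posProj_attains (O U) (hO U) (z U) (hG U)).2.1,
    (posProj_attains (O U) (hO U) (z U) (hG U)).2.2.1⟩, ?_⟩
  rw [value_eq_sum_response]
  exact sum_congr rfl fun U _ => (posProj_attains (O U) (hO U) (z U) (hG U)).2.2.2

/-! ### §3 Consequence for the crux functional: tightness only lowers the cut side's optimum -/

/-- **`TracialValueLEAt` from a response bound.** If for every family of contractions `Y_M` and every eigen-decomposition of
its responses the normalised positive-eigenvalue sum is `≤ γ`, then `TracialValueLEAt W γ r`: every tight-orthogonal psd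
rectangle of dimension `r` has normalised value `≤ γ`. [cite: GriblingDelaatLaurent2019, §5] [cite: Rothvoss2017, §2 (PDF pp. 6–7)] -/
theorem tracialValueLEAt_of_response_bound (W : OddSet n → PMatch n → ℝ) (γ : ℝ)
    (h : ∀ (Y : PMatch n → Matrix (Fin r) (Fin r) ℝ), (∀ M, (Y M).PosSemidef ∧ (1 - Y M).PosSemidef) →
      ∀ (O : OddSet n → Matrix (Fin r) (Fin r) ℝ) (z : OddSet n → Fin r → ℝ), (∀ U, (O U)ᵀ * O U = 1) →
        (∀ U, (∑ M, W U M • Y M) = O U * diagonal (z U) * (O U)ᵀ) → (∑ U, ∑ i, max 0 (z U i)) / (r : ℝ) ≤ γ) :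
    TracialValueLEAt W γ r := by
  intro X Y hXY
  obtain ⟨O, z, hO, hG⟩ := exists_eigenbasis_response W (fun M => (hXY.2.1 M).1.1)
  have hle := value_le_sum_posPart W Y hXY.1 O z hO hG
  rcases Nat.eq_zero_or_pos r with hr | hr
  · subst hr
    have h0 := h Y hXY.2.1 O z hO hG
    simp only [Nat.cast_zero, div_zero] at h0 ⊢
    exact h0
  · exact (div_le_div_of_nonneg_right hle (Nat.cast_nonneg r)).trans (h Y hXY.2.1 O z hO hG)

/-- **The unconstrained cut-side supremum, in closed form.** For contractions `Y_M` with response eigen-data `(O, z)`: the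
maximum of `Σ W tr(X_U Y_M)` over ALL contraction families `X` equals `Σ_U Σ_i max(0, z_U(i))` (upper bound
`value_le_sum_posPart` + attainment `value_posProj_eq`), i.e. the see-saw half-step of the engine's T2 numerics is exact. -/
theorem isGreatest_unconstrained_value (W : OddSet n → PMatch n → ℝ) (Y : PMatch n → Matrix (Fin r) (Fin r) ℝ)
    (O : OddSet n → Matrix (Fin r) (Fin r) ℝ) (z : OddSet n → Fin r → ℝ) (hO : ∀ U, (O U)ᵀ * O U = 1)
    (hG : ∀ U, (∑ M, W U M • Y M) = O U * diagonal (z U) * (O U)ᵀ) :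
    IsGreatest {v : ℝ | ∃ X : OddSet n → Matrix (Fin r) (Fin r) ℝ, (∀ U, (X U).PosSemidef ∧ (1 - X U).PosSemidef) ∧
        v = ∑ U, ∑ M, W U M * (X U * Y M).trace} (∑ U, ∑ i, max 0 (z U i)) := by
  refine ⟨⟨fun U => (O U * diagonal (fun i => if 0 < z U i then (1 : ℝ) else 0) * (O U)ᵀ), fun U => ⟨((value_posProj_eq W Y O z hO hG).1 U).1,
    ((value_posProj_eq W Y O z hO hG).1 U).2.1⟩, (value_posProj_eq W Y O z hO hG).2.symm⟩, ?_⟩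
  rintro v ⟨X, hX, rfl⟩
  exact value_le_sum_posPart W Y hX O z hO hG

end Summit.PneNP.PneNP.Theorems.ChebyshevTracialDesignPsdBestResponse
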